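import Summits.ABC.ABC.Theorems.TwistAmplificationMazurKaneLawRecordDEDictionary
import Summits.ABC.ABC.Theorems.TwistAmplificationMazurKaneLawRecordDEEndgame
import Summits.ABC.ABC.Theorems.TwistAmplificationMazurKaneLawRecordLPDEAdapterAt
import Summits.ABC.ABC.Theorems.TwistAmplificationMazurKaneLawRecordLPDE2
import Summits.ABC.ABC.Theorems.TwistAmplificationMazurKaneLawRecordTransfer
import Summits.ABC.ABC.Theorems.TwistAmplificationMazurKaneLawRecordsV3

/-!
# Certified record exponents, pipeline v3 (the DE tool) — record `DE2` below the wall, `s₀ ∈ [5/3, 16/9]`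
# (crux `TwistAmplification.MazurKaneLaw`, stmt-ABC-2757)

Line `critical-kloosterman-powerful-moduli`, lead c4. With the DE family the exact `J = 4` LP value below the wall is
`V₄(s) = (7s + 31)/46` on `[5/3, 16/9]` (grid `.92754 / .93261 / .93565 / .94022 / .94174 / .94445` at `5/3, 1.7, 1.72, 7/4, 1.76, 16/9`,
continuous with the plateau value `(2+s)/4` at the wall: `17/18`); the parametric certificate `lp_DE2` (`K = 3`, slack-mode intercept
`422/625 = 0.6752 ≥ 31/46 + 0.00125`, 1849 nodes / 1591 leaves in eight files) gives

* `recordAt_DE2` : for every `s₀ ∈ [5/3, 16/9]`, `RecordAt s₀ (7 s₀/46 + 422/625)` — certified `.9288 / .9415 / .9457` at `5/3 / 7/4 / 16/9`,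
  against the previous `recordAt_53 = .96`, `recordAt_74 = .98`, `recordAt_RF(7/4) = .9778`, `recordAt_RF(16/9) = 1`.

In the crux's literal shape (`mazurKane_count_le_rpow_DE2`): for `5/3 ≤ s < 16/9` and `ε > 0`,
`#{abc triples (a,b,c) : c ≤ N, rad(abc) ≤ c^s} ≤ C · N^{7s/46 + 422/625 + ε}`.
-/

noncomputable section

-- `Summit.<Summit>.<Problem>`: the duplicate `ABC.ABC` is deliberate (single-conjunct summit).
set_option linter.dupNamespace false

namespace Summit.ABC.ABC.Theorems.MazurKaneLaw

open Summit.ABC.ABC.Theorems.MazurKaneLaw.Toolkit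

/-! ### `DE2`: `s₀ ∈ [5/3, 16/9]`, exponent `7 s₀/46 + 422/625` -/

/-- **Parametric DE record instance below the wall**: for every `s₀ ∈ [5/3, 16/9]`, `RecordInstanceDE 3 4 s₀ (7 s₀/46 + 422/625)`, from
the generated parametric LP lemma `lp_DE2` (bundle form) through the pointwise adapter and the DE dictionary. [folklore] -/
theorem recordInstanceDE_mid : ∀ s₀ : ℝ, 5 / 3 ≤ s₀ → s₀ ≤ 16 / 9 →
    Summit.ABC.ABC.Theorems.MazurKaneLaw.Toolkit.RecordInstanceDE 3 4 s₀ ((7 / 46 : ℝ) * s₀ + (422 / 625 : ℝ)) :=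
  fun s₀ h1 h2 => recordInstanceDE_of_lpCertDE 3 4 s₀ _ (by norm_num)
    (lpCertDE_of_lpHypsDE4_at 3 s₀ _ (lp_DE2 s₀ h1 h2))

/-- **Parametric certified record `DE2`** (registered sub-goal `recordAt_DE2` of crux stmt-ABC-2757): for every `s₀ ∈ [5/3, 16/9]`,
every `s < s₀` and `ε > 0`, `#{abc triples, c ≤ N, rad(abc) ≤ c^s} ≤ C · N^{7 s₀/46 + 422/625 + ε}` for `N ≥ 2`. [folklore] -/
theorem recordAt_DE2 : ∀ s₀ : ℝ, 5 / 3 ≤ s₀ → s₀ ≤ 16 / 9 → Summit.ABC.ABC.Theorems.MazurKaneLaw.Toolkit.RecordAt s₀ ((7 / 46 : ℝ) * s₀ + (422 / 625 : ℝ)) :=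
  fun s₀ h1 h2 => recordAt_of_shapeBound 4 s₀ ((7 / 46 : ℝ) * s₀ + (422 / 625 : ℝ)) (by norm_num) (by norm_num) (by linarith)
    (by linarith) (shapeCount_le_of_recordInstanceDE 3 4 s₀ ((7 / 46 : ℝ) * s₀ + (422 / 625 : ℝ)) (by norm_num) (by norm_num)
      (by linarith) (recordInstanceDE_mid s₀ h1 h2))

/-- **`DE2` in the crux's literal shape**: for `5/3 ≤ s < 16/9` and `ε > 0` there is `C` with
`#{abc triples (a,b,c) : c ≤ N, rad(abc) ≤ c^s} ≤ C · N^{7s/46 + 422/625 + ε}` for all `N ≥ 2`. Take `s₀ = min (16/9) (s + ε)` in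
`recordAt_DE2` with `ε′ = ε/3`. [folklore] -/
theorem mazurKane_count_le_rpow_DE2 (s : ℝ) (hs1 : 5 / 3 ≤ s) (hs2 : s < 16 / 9) (ε : ℝ) (hε : 0 < ε) :
    ∃ C : ℝ, ∀ N : ℕ, 2 ≤ N →
      (Set.ncard {t : ℕ × ℕ × ℕ | Literature.NumberTheory.DiophantineGeometry.IsABCTriple t.1 t.2.1 t.2.2 ∧ t.2.2 ≤ N ∧ ((Literature.NumberTheory.DiophantineGeometry.rad t.1 t.2.1 t.2.2 : ℕ) : ℝ) ≤ (t.2.2 : ℝ) ^ s} : ℝ) ≤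
        C * (N : ℝ) ^ (7 * s / 46 + 422 / 625 + ε) := by
  -- adapted from `mazurKane_count_le_rpow_DE` (TwistAmplificationMazurKaneLawRecordsV6.lean)
  have hm1 : min (16 / 9) (s + ε) ≤ 16 / 9 := min_le_left _ _
  have hm2 : min (16 / 9) (s + ε) ≤ s + ε := min_le_right _ _
  have hm3 : s < min (16 / 9) (s + ε) := lt_min hs2 (by linarith)
  obtain ⟨C, hC⟩ := recordAt_DE2 (min (16 / 9) (s + ε)) (by linarith) hm1 s hm3 (ε / 3) (by positivity)
  exact ⟨max C 0, fun N hN => record_bound_mono hN (by linarith) (hC N hN)⟩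

end Summit.ABC.ABC.Theorems.MazurKaneLaw

end
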